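import Summits.HubbardSuperconductivity.HubbardSuperconductivity.Theorems.WidthHaldaneFeshbachStep
import Summits.HubbardSuperconductivity.HubbardSuperconductivity.Theorems.WidthHaldaneTubeCanonical

/-!
# The low-energy WINDOW form of the Haldane law is EXACT (crux `WidthHaldaneBridge`, stmt-HubbardSuperconductivity-16311)

Crux `WidthHaldaneBridge` (routes `WidthHaldane`, `SeamInduction`) concludes a pointwise floor
`A·L·M²·r̂^{-Ξ√(ẽ″/ρ̃)/M} ≤ G_ψ(r)` on the column `d_{x²-y²}` pair correlator `G_ψ(r) = tubeColumnPairCorr …`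
of every normalised sector GROUND STATE `ψ` of the pure tube (`HaldaneLaw`, `Theorems/WidthHaldaneDefs.lean`).
Line `IdeaSketchK2` of the crux (card `frustration-cost-duality`, `Cruxes/WidthHaldaneBridge/Lines/IdeaSketchK2.lean`)
kept as its core A (`stub_windowBridge`) the LOW-ENERGY WINDOW LAW: the same floor for every normalised sector
vector `φ` of energy `Re⟨φ, H₀φ⟩ ≤ E₀ + Ω(L, M, r)`, some window `Ω > 0`; the landed Feshbach step
(`Theorems/WidthHaldaneFeshbachStep.lean`, `haldaneLaw_of_windowLaw`) gives window law ⇒ law, same constants.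
The lead's dead-line note (`Lines/IdeaSketchK2-dead.md`, item 1) records, unformalised, that below the spectral
gap of the finite tube the window law FOLLOWS from the law. This file PROVES it, so that the third formulation
of the crux is certified exact like the energy dual (`WidthHaldaneDualExact.widthHaldaneBridge_iff_dualBridge`):

* `exists_window_of_ground_floor` — GENERIC converse of the Feshbach step: `H`, `Y` Hermitian, `K` an
  `H`-invariant sector, a floor `c‖ψ‖² ≤ Re⟨ψ, Yψ⟩`, `c > 0`, on the sector ground multiplet (`ψ ∈ K`,
  `Hψ = e₀ψ`). Then for some `Ω > 0` every `v ∈ K` with `Re⟨v, Hv⟩ ≤ (e₀ + Ω)‖v‖²` has `(c/2)‖v‖² ≤ Re⟨v, Yv⟩`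
  (split `v = p + w` along the ground multiplet and its orthogonal complement in `K`; `w` feels the gap
  `g > 0` above `e₀` (`exists_gap_above_groundMultiplet`), so `‖w‖ ≤ ε‖p‖` in the window `Ω = gε²/(1+ε²)`;
  the cross term is `≤ 2‖Y‖‖p‖‖w‖`; `ε = c/(6‖Y‖ + c)`);
* `exists_window_at` — on one admissible tube, labelling and displacement, `HaldaneLaw (Ξ, A, R, M₂, L₁)` with
  `A > 0` gives a window below which the floor holds with amplitude `A/2` (the law floors `Re⟨ψ, X_rψ⟩ = 2G_ψ(r)`
  on the ground multiplet by homogeneity; `r̂^{-x} = 0` only at `r = 0`, where `G_φ(0) ≥ 0`);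
* `windowLaw_of_haldaneLaw` — **law `(Ξ, A, R, M₂, L₁)` ⇒ window law `(Ξ, A/2, R, M₂, L₁)`** with ONE window
  function `Ω : ℕ → ℕ → ℕ → ℝ` of `(L, M, r.val)`, positive everywhere, serving every labelling: read off the
  canonical carrier `Fin (L·M)` and transported by the signed-permutation relabelling (`WidthHaldaneTubeCanonical`,
  `WidthHaldaneTubeKinematics`, Literature `SiteBijectionSectorTransport`);
* `windowBridge_iff_widthHaldaneBridge` — **core A of line `IdeaSketchK2` ⟺ the crux** (`→` is the line's
  composition A): the window bridge is a restatement of `WidthHaldaneBridge`; with the dual certificate the crux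
  is certified equivalent to every exit of `Lines/IdeaSketchK2-dead.md` that does not mention `‖Δψ‖²`.

No definitions, no named facts. Sources for the objects only: T. Kato, *Perturbation Theory for Linear
Operators* (1966) II-§6.1; H. Tasaki, *Physics and Mathematics of Quantum Many-Body Systems* (2020) §2.2;
H. Feshbach, Ann. Phys. 5 (1958) 357 (name of the step only). REUSED: `exists_gap_above_groundMultiplet`,
`projMatrix_map_mulVec_*`, `abs_re_dotProduct_mulVec_le`, `exists_normalize`, `re_form_columnPairSource`,
`haldaneLaw_of_windowLaw`, `relabel_tubeH0`, `tubeColumnPairCorr_relabelVec`, `minEnergyOn_relabel_szSector`.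
-/


noncomputable section

namespace Summit.HubbardSuperconductivity.HubbardSuperconductivity.Theorems.WidthHaldane

set_option linter.dupNamespace false -- summit = problem name (single-conjunct summit), D-0017

open scoped BigOperators Classical Matrix ComplexConjugate Matrix.Norms.L2Operator
open Matrix Literature.MathematicalPhysics.QuantumLattice
  Literature.MathematicalPhysics.QuantumLattice.EigenvalueContinuation
  Literature.Computability.AlgebraicComplexity
open Summit.HubbardSuperconductivity.HubbardSuperconductivity.Theses.WidthHaldane (WidthHaldaneBridge)

/-! ### The generic converse of the Feshbach step -/

section Generic

variable {ι : Type*} [Fintype ι] [DecidableEq ι]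

/-- **A ground-multiplet floor survives in a low-energy window** (converse of the Feshbach step
`exists_minEnergyOn_add_smul_ge_of_window`). Let `H`, `Y` be Hermitian, `K` an `H`-invariant sector,
`e₀ = minEnergyOn H K`, and suppose `c‖ψ‖² ≤ Re⟨ψ, Yψ⟩`, `c > 0`, for every `ψ ∈ K` with `Hψ = e₀ψ`.
Then there is a window `Ω > 0` such that every `v ∈ K` with `Re⟨v, Hv⟩ ≤ (e₀ + Ω)‖v‖²` satisfies
`(c/2)‖v‖² ≤ Re⟨v, Yv⟩`. (Split `v = p + w`, `p` in the ground multiplet, `w ∈ K` orthogonal to it: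
`Re⟨v, Hv⟩ ≥ e₀‖p‖² + (e₀ + g)‖w‖²` by the gap `g > 0` above the multiplet, so inside the window
`Ω = gε²/(1 + ε²)` one has `‖w‖² ≤ ε²‖p‖²`; then
`Re⟨v, Yv⟩ ≥ c‖p‖² - 2‖Y‖‖p‖‖w‖ - ‖Y‖‖w‖² ≥ (c - 3ε‖Y‖)‖p‖² ≥ (c/2)(1 + ε²)‖p‖²` for
`ε = c/(6‖Y‖ + c) ≤ 1`.) Kato (1966) II-§6.1. [folklore] -/
theorem exists_window_of_ground_floor {H Y : Matrix ι ι ℂ} (hH : H.IsHermitian)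
    (hY : Y.IsHermitian) (K : Submodule ℂ (ι → ℂ)) (hKH : ∀ v ∈ K, H *ᵥ v ∈ K)
    {c : ℝ} (hc : 0 < c)
    (hfloor : ∀ ψ ∈ K, H *ᵥ ψ = ((H.minEnergyOn K : ℝ) : ℂ) • ψ →
      c * (star ψ ⬝ᵥ ψ).re ≤ (star ψ ⬝ᵥ Y *ᵥ ψ).re) :
    ∃ Ω : ℝ, 0 < Ω ∧ ∀ v ∈ K,
      (star v ⬝ᵥ H *ᵥ v).re ≤ (H.minEnergyOn K + Ω) * (star v ⬝ᵥ v).re →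
        c / 2 * (star v ⬝ᵥ v).re ≤ (star v ⬝ᵥ Y *ᵥ v).re := by
  classical
  obtain ⟨g, hg, hgap⟩ := exists_gap_above_groundMultiplet hH K hKH
  set m : ℝ := H.minEnergyOn K with hm_def
  set B : ℝ := ‖Y‖ with hB_def
  have hB : 0 ≤ B := norm_nonneg _
  -- the ratio `ε = c/(6B + c) ∈ (0, 1]` and the window `Ω = g ε²/(1 + ε²)`
  set ε : ℝ := c / (6 * B + c) with hε_def
  have hden : 0 < 6 * B + c := by positivity
  have hε : 0 < ε := by positivity
  have hε1 : ε ≤ 1 := by rw [hε_def, div_le_one hden]; linarith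
  have hεc : ε * (6 * B + c) = c := by rw [hε_def, div_mul_cancel₀ _ hden.ne']
  refine ⟨g * ε ^ 2 / (1 + ε ^ 2), by positivity, fun v hv hvwin => ?_⟩
  set E : Submodule ℂ (ι → ℂ) := K ⊓ Module.End.eigenspace (Matrix.toLin' H) (m : ℂ) with hE_def
  set P : Matrix ι ι ℂ := projMatrix (E.map
    ((WithLp.linearEquiv 2 ℂ (ι → ℂ)).symm : (ι → ℂ) →ₗ[ℂ] EuclideanSpace ℂ ι)) with hP_def
  have hPh : P.IsHermitian := projMatrix_isHermitian _
  have hmemE : ∀ ψ, ψ ∈ E ↔ ψ ∈ K ∧ H *ᵥ ψ = (m : ℂ) • ψ := fun ψ =>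
    mem_inf_eigenspace_toLin'_iff H K m ψ
  set p : ι → ℂ := P *ᵥ v with hp_def
  set w : ι → ℂ := v - p with hw_def
  have hpE : p ∈ E := projMatrix_map_mulVec_mem E v
  obtain ⟨hpK, hHp⟩ := (hmemE p).1 hpE
  have hwK : w ∈ K := K.sub_mem hv hpK
  have hPψ : ∀ ψ ∈ E, star ψ ⬝ᵥ p = star ψ ⬝ᵥ v := by
    intro ψ hψ
    have hfix : P *ᵥ ψ = ψ := projMatrix_map_mulVec_of_mem E hψ
    rw [hp_def]
    conv_rhs => rw [← hfix]
    rw [star_mulVec, hPh.eq, ← dotProduct_mulVec]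
  have hworth : ∀ ψ ∈ K, H *ᵥ ψ = (m : ℂ) • ψ → star ψ ⬝ᵥ w = 0 := by
    intro ψ hψK hψ
    rw [hw_def, dotProduct_sub, hPψ ψ ((hmemE ψ).2 ⟨hψK, hψ⟩), sub_self]
  have hgapw := hgap w hwK hworth
  have hpw : star p ⬝ᵥ w = 0 := hworth p hpK hHp
  have hwp : star w ⬝ᵥ p = 0 := by rw [star_dotProduct, hpw, star_zero]
  have hwHp : star w ⬝ᵥ H *ᵥ p = 0 := by rw [hHp, dotProduct_smul, hwp, smul_zero]
  have hpHw : star p ⬝ᵥ H *ᵥ w = 0 := by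
    rw [star_dotProduct_mulVec_comm hH.eq, hwHp, star_zero]
  have hv_eq : v = p + w := by rw [hw_def, add_sub_cancel]
  have h1 : star v ⬝ᵥ H *ᵥ v = (m : ℂ) * (star p ⬝ᵥ p) + star w ⬝ᵥ H *ᵥ w := by
    conv_lhs => rw [hv_eq]
    rw [mulVec_add, star_add, add_dotProduct, dotProduct_add, dotProduct_add, hpHw, hwHp,
      hHp, dotProduct_smul, smul_eq_mul]
    ring
  have h2 : star v ⬝ᵥ v = star p ⬝ᵥ p + star w ⬝ᵥ w := by
    conv_lhs => rw [hv_eq]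
    rw [star_add, add_dotProduct, dotProduct_add, dotProduct_add, hpw, hwp]
    ring
  -- the `Y`-form split: `⟨v, Yv⟩ = ⟨p, Yp⟩ + ⟨p, Yw⟩ + ⟨w, Yp⟩ + ⟨w, Yw⟩`, middle terms conjugate
  have h3 : (star v ⬝ᵥ Y *ᵥ v).re =
      (star p ⬝ᵥ Y *ᵥ p).re + 2 * (star p ⬝ᵥ Y *ᵥ w).re + (star w ⬝ᵥ Y *ᵥ w).re := by
    have hconj : (star w ⬝ᵥ Y *ᵥ p).re = (star p ⬝ᵥ Y *ᵥ w).re := by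
      rw [star_dotProduct_mulVec_comm hY.eq, Complex.star_def, Complex.conj_re]
    conv_lhs => rw [hv_eq]
    rw [mulVec_add, star_add, add_dotProduct, dotProduct_add, dotProduct_add]
    simp only [Complex.add_re]
    rw [hconj]
    ring
  have hfl : c * (star p ⬝ᵥ p).re ≤ (star p ⬝ᵥ Y *ᵥ p).re := hfloor p hpK hHp
  have hcross : |(star p ⬝ᵥ Y *ᵥ w).re| ≤ B * eucNorm p * eucNorm w :=
    abs_re_dotProduct_mulVec_le Y p w
  have hww : |(star w ⬝ᵥ Y *ᵥ w).re| ≤ B * eucNorm w * eucNorm w :=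
    abs_re_dotProduct_mulVec_le Y w w
  have hpp : (star p ⬝ᵥ p).re = eucNorm p ^ 2 := (eucNorm_sq p).symm
  have hwwn : (star w ⬝ᵥ w).re = eucNorm w ^ 2 := (eucNorm_sq w).symm
  have hp0 : 0 ≤ eucNorm p := eucNorm_nonneg p
  have hw0 : 0 ≤ eucNorm w := eucNorm_nonneg w
  have h1re : (star v ⬝ᵥ H *ᵥ v).re = m * eucNorm p ^ 2 + (star w ⬝ᵥ H *ᵥ w).re := by
    rw [h1, Complex.add_re, Complex.re_ofReal_mul, hpp]
  have h2re : (star v ⬝ᵥ v).re = eucNorm p ^ 2 + eucNorm w ^ 2 := by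
    rw [h2, Complex.add_re, hpp, hwwn]
  rw [h2re] at hvwin ⊢
  rw [h1re] at hvwin
  rw [h3]
  rw [hwwn] at hgapw
  rw [hpp] at hfl
  have hcr := (abs_le.1 hcross).1
  have hwr := (abs_le.1 hww).1
  set s := eucNorm p with hs
  set t := eucNorm w with ht
  -- inside the window: `g t² ≤ Ω (s² + t²)`, i.e. `t² ≤ ε² s²`
  have hgt : g * t ^ 2 ≤ g * ε ^ 2 / (1 + ε ^ 2) * (s ^ 2 + t ^ 2) := by linarith [hgapw, hvwin]
  have ht2 : t ^ 2 ≤ ε ^ 2 * s ^ 2 := by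
    have h1e : (0 : ℝ) < 1 + ε ^ 2 := by positivity
    have hΩeq : g * ε ^ 2 / (1 + ε ^ 2) * (1 + ε ^ 2) = g * ε ^ 2 := div_mul_cancel₀ _ h1e.ne'
    have hmul : g * t ^ 2 * (1 + ε ^ 2) ≤ g * ε ^ 2 * (s ^ 2 + t ^ 2) := by
      calc g * t ^ 2 * (1 + ε ^ 2) ≤ g * ε ^ 2 / (1 + ε ^ 2) * (s ^ 2 + t ^ 2) * (1 + ε ^ 2) :=
            mul_le_mul_of_nonneg_right hgt h1e.le
        _ = g * ε ^ 2 * (s ^ 2 + t ^ 2) := by rw [mul_right_comm, hΩeq]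
    have hmul' : g * t ^ 2 ≤ g * (ε ^ 2 * s ^ 2) := by linarith [hmul]
    exact le_of_mul_le_mul_left hmul' hg
  have hst : s * t ≤ ε * s ^ 2 := by
    have hεs : 0 ≤ ε * s := mul_nonneg hε.le hp0
    have htle : t ≤ ε * s := by
      have h' : t ^ 2 ≤ (ε * s) ^ 2 := by rw [mul_pow]; exact ht2
      have habs : |t| ≤ |ε * s| := sq_le_sq.1 h'
      exact (le_abs_self t).trans (habs.trans_eq (abs_of_nonneg hεs))
    calc s * t ≤ s * (ε * s) := mul_le_mul_of_nonneg_left htle hp0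
      _ = ε * s ^ 2 := by ring
  have hε2 : ε ^ 2 ≤ ε := by
    calc ε ^ 2 = ε * ε := sq ε
      _ ≤ ε * 1 := mul_le_mul_of_nonneg_left hε1 hε.le
      _ = ε := mul_one ε
  have hcoef : 2 * B * ε + B * ε ^ 2 + c / 2 * ε ^ 2 ≤ c / 2 := by
    have i1 : B * ε ^ 2 ≤ B * ε := mul_le_mul_of_nonneg_left hε2 hB
    have i2 : c / 2 * ε ^ 2 ≤ c / 2 * ε := mul_le_mul_of_nonneg_left hε2 (by positivity)
    have i3 : 2 * B * ε + B * ε + c / 2 * ε = c / 2 := by linear_combination hεc / 2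
    linarith
  have hs2 : 0 ≤ s ^ 2 := sq_nonneg s
  -- the chain `Re⟨v,Yv⟩ ≥ c s² - 2B st - B t² ≥ (c - 2Bε - Bε²) s² ≥ (c/2)(1 + ε²) s² ≥ (c/2)(s² + t²)`
  have e1 : 2 * B * (s * t) ≤ 2 * B * (ε * s ^ 2) := mul_le_mul_of_nonneg_left hst (by positivity)
  have e2 : B * t ^ 2 ≤ B * (ε ^ 2 * s ^ 2) := mul_le_mul_of_nonneg_left ht2 hB
  have e3 : c / 2 * t ^ 2 ≤ c / 2 * (ε ^ 2 * s ^ 2) := mul_le_mul_of_nonneg_left ht2 (by positivity)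
  have e4 : (2 * B * ε + B * ε ^ 2 + c / 2 * ε ^ 2) * s ^ 2 ≤ c / 2 * s ^ 2 :=
    mul_le_mul_of_nonneg_right hcoef hs2
  have hcr' : -(B * (s * t)) ≤ (star p ⬝ᵥ Y *ᵥ w).re := by rw [← mul_assoc]; exact hcr
  have hwr' : -(B * t ^ 2) ≤ (star w ⬝ᵥ Y *ᵥ w).re := by rw [sq, ← mul_assoc]; exact hwr
  linarith [hfl, hcr', hwr', e1, e2, e3, e4]

end Generic

/-! ### The window law on one tube, labelling and displacement -/

section Tube

variable (L M : ℕ) [NeZero L] [NeZero M] (Λ : Type) [LinearOrder Λ] [Fintype Λ]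
  (e : Λ ≃ ZMod L × ZMod M)

/-- **The law puts a window floor on one tube.** If `HaldaneLaw U δ Ξ A R M₂ L₁` holds with `A > 0`,
then on every admissible tube `(L, M)`, labelling `e` and displacement `r` with
`R ≤ r̂` there is a window `Ω > 0` such that every normalised `(N_{L,M}(δ), S^z = 0)` sector vector
`φ` of energy `Re⟨φ, H₀φ⟩ ≤ E₀ + Ω` obeys the floor with HALF the amplitude,
`(A/2)·L·M²·r̂^{-Ξ√(ẽ″/ρ̃)/M} ≤ G_φ(r)`: the law floors `Re⟨ψ, X_r ψ⟩ = 2G_ψ(r)` by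
`2A·L·M²·r̂^{-x}·‖ψ‖²` on the whole ground multiplet (homogeneity), and `exists_window_of_ground_floor`
halves it inside a window; the degenerate instance `r̂^{-x} = 0` (only `r = 0`) is `G_φ(0) ≥ 0`.
[folklore] -/
theorem exists_window_at {U δ Ξ A : ℝ} {R M₂ L₁ : ℕ} (hA : 0 < A)
    (hlaw : HaldaneLaw U δ Ξ A R M₂ L₁) (hLe : Even L) (hMe : Even M) (hM : M₂ ≤ M) (hML : M ≤ L)
    (hL : L₁ ≤ L) (r : ZMod L) (hr : R ≤ r.val) (hrL : r.val + R ≤ L) :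
    ∃ Ω : ℝ, 0 < Ω ∧ ∀ φ : Fock (Orb Λ), φ ∈ szSector (tubeFilling L M δ) 0 → star φ ⬝ᵥ φ = 1 →
      (expect (tubeH0 L M Λ e U) φ).re ≤
          (tubeH0 L M Λ e U).minEnergyOn (szSector (tubeFilling L M δ) 0) + Ω →
        (A / 2) * (L : ℝ) * (M : ℝ) ^ 2 * ((min r.val (L - r.val) : ℕ) : ℝ) ^
            (-(Ξ * Real.sqrt (tubePairCompressibility L M Λ e U δ / tubeStiffness L M Λ e U δ) / (M : ℝ))) ≤
          tubeColumnPairCorr L M Λ e φ r := by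
  have hH := isHermitian_tubeH0 L M Λ e U
  have hY := isHermitian_columnPairRepulsion L M Λ e r
  set fl : ℝ := A * (L : ℝ) * (M : ℝ) ^ 2 * ((min r.val (L - r.val) : ℕ) : ℝ) ^ (-(Ξ * Real.sqrt (tubePairCompressibility L M Λ e U δ / tubeStiffness L M Λ e U δ) / (M : ℝ))) with hfl_def
  have hfl0 : 0 ≤ fl := by
    have : (0 : ℝ) ≤ ((min r.val (L - r.val) : ℕ) : ℝ) := Nat.cast_nonneg _
    positivity
  have hhalf : (A / 2) * (L : ℝ) * (M : ℝ) ^ 2 * ((min r.val (L - r.val) : ℕ) : ℝ) ^ (-(Ξ * Real.sqrt (tubePairCompressibility L M Λ e U δ / tubeStiffness L M Λ e U δ) / (M : ℝ))) = fl / 2 := by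
    rw [hfl_def]; ring
  rw [hhalf]
  rcases hfl0.lt_or_eq with hpos | hzero
  · -- the law floors `Re⟨ψ, X_r ψ⟩` by `2 fl ‖ψ‖²` on the ground multiplet
    have hfloor : ∀ ψ ∈ szSector (tubeFilling L M δ) 0,
        tubeH0 L M Λ e U *ᵥ ψ =
          (((tubeH0 L M Λ e U).minEnergyOn (szSector (tubeFilling L M δ) 0) : ℝ) : ℂ) • ψ →
        2 * fl * (star ψ ⬝ᵥ ψ).re ≤ (star ψ ⬝ᵥ (∑ a : ZMod L, ((∑ b : ZMod M, tubeDWavePair L M Λ e (e.symm (a, b)))ᴴ * (∑ b : ZMod M, tubeDWavePair L M Λ e (e.symm (a + r, b))) + (∑ b : ZMod M, tubeDWavePair L M Λ e (e.symm (a + r, b)))ᴴ * (∑ b : ZMod M, tubeDWavePair L M Λ e (e.symm (a, b))))) *ᵥ ψ).re := by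
      intro ψ hψK hψ
      by_cases hψ0 : ψ = 0
      · simp [hψ0]
      obtain ⟨c, hc, hcc, hc1⟩ := exists_normalize hψ0
      have hGS : IsGroundStateInSector (tubeH0 L M Λ e U) (tubeFilling L M δ) 0 ((c : ℂ) • ψ) :=
        ⟨Submodule.smul_mem _ _ hψK, smul_ne_zero (by exact_mod_cast hc.ne') hψ0,
          by rw [mulVec_smul, hψ, smul_comm]⟩
      have key := hlaw L M hLe hMe hM hML hL Λ e ((c : ℂ) • ψ) hc1 hGS r hr hrL
      have hform := re_form_columnPairSource L M Λ e ((c : ℂ) • ψ) r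
      rw [mulVec_smul, star_real_smul_dotProduct_real_smul, Complex.re_ofReal_mul] at hform
      have h1 : 2 * fl ≤ c * c * (star ψ ⬝ᵥ (∑ a : ZMod L, ((∑ b : ZMod M, tubeDWavePair L M Λ e (e.symm (a, b)))ᴴ * (∑ b : ZMod M, tubeDWavePair L M Λ e (e.symm (a + r, b))) + (∑ b : ZMod M, tubeDWavePair L M Λ e (e.symm (a + r, b)))ᴴ * (∑ b : ZMod M, tubeDWavePair L M Λ e (e.symm (a, b))))) *ᵥ ψ).re := by
        rw [hform]; linarith
      have hpos' : 0 < (star ψ ⬝ᵥ ψ).re := re_star_dotProduct_self_pos hψ0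
      calc 2 * fl * (star ψ ⬝ᵥ ψ).re
          ≤ c * c * (star ψ ⬝ᵥ (∑ a : ZMod L, ((∑ b : ZMod M, tubeDWavePair L M Λ e (e.symm (a, b)))ᴴ * (∑ b : ZMod M, tubeDWavePair L M Λ e (e.symm (a + r, b))) + (∑ b : ZMod M, tubeDWavePair L M Λ e (e.symm (a + r, b)))ᴴ * (∑ b : ZMod M, tubeDWavePair L M Λ e (e.symm (a, b))))) *ᵥ ψ).re * (star ψ ⬝ᵥ ψ).re :=
            mul_le_mul_of_nonneg_right h1 hpos'.le
        _ = (star ψ ⬝ᵥ (∑ a : ZMod L, ((∑ b : ZMod M, tubeDWavePair L M Λ e (e.symm (a, b)))ᴴ * (∑ b : ZMod M, tubeDWavePair L M Λ e (e.symm (a + r, b))) + (∑ b : ZMod M, tubeDWavePair L M Λ e (e.symm (a + r, b)))ᴴ * (∑ b : ZMod M, tubeDWavePair L M Λ e (e.symm (a, b))))) *ᵥ ψ).re * (c * c * (star ψ ⬝ᵥ ψ).re) := by ring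
        _ = _ := by rw [hcc, mul_one]
    obtain ⟨Ω, hΩ, hwin⟩ := exists_window_of_ground_floor hH hY (szSector (tubeFilling L M δ) 0)
      (fun v hv => tubeH0_mulVec_mem_szSector_tubeFilling L M Λ e U δ hv) (by positivity) hfloor
    refine ⟨Ω, hΩ, fun φ hφK hφ1 hφwin => ?_⟩
    have hw : (star φ ⬝ᵥ tubeH0 L M Λ e U *ᵥ φ).re ≤
        ((tubeH0 L M Λ e U).minEnergyOn (szSector (tubeFilling L M δ) 0) + Ω) * (star φ ⬝ᵥ φ).re := by
      rw [hφ1, Complex.one_re, mul_one]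
      rwa [expect] at hφwin
    have key := hwin φ hφK hw
    rw [hφ1, Complex.one_re, mul_one, re_form_columnPairSource] at key
    linarith
  · -- degenerate floor: `r̂^(-x) = 0`, hence `r = 0` and `G_φ(0) ≥ 0`
    have hr0 : r = 0 := by
      have hx : ((min r.val (L - r.val) : ℕ) : ℝ) ^
          (-(Ξ * Real.sqrt (tubePairCompressibility L M Λ e U δ / tubeStiffness L M Λ e U δ) / (M : ℝ))) = 0 := by
        have hLM : (0 : ℝ) < A * (L : ℝ) * (M : ℝ) ^ 2 := by
          have hL0 : (0 : ℝ) < L := Nat.cast_pos.2 (NeZero.pos L)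
          have hM0 : (0 : ℝ) < M := Nat.cast_pos.2 (NeZero.pos M)
          positivity
        have := hzero
        rw [hfl_def] at this
        rcases mul_eq_zero.1 this.symm with h1 | h1
        · exact absurd h1 hLM.ne'
        · exact h1
      have hbase := ((Real.rpow_eq_zero_iff_of_nonneg (Nat.cast_nonneg _)).1 hx).1
      have hmin : min r.val (L - r.val) = 0 := by exact_mod_cast hbase
      have hrv : r.val = 0 := by
        have := r.val_lt; omega
      exact (ZMod.val_eq_zero r).1 hrv
    subst hr0
    refine ⟨1, one_pos, fun φ _ _ _ => ?_⟩
    rw [← hzero, zero_div]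
    exact tubeColumnPairCorr_zero_nonneg L M Λ e φ

end Tube

/-! ### Law ⇒ window law, one window function for all labellings -/

/-- **HALDANE LAW ⇒ LOW-ENERGY WINDOW LAW, half the amplitude.** If `HaldaneLaw U δ Ξ A R M₂ L₁`
holds with `A > 0` (any real `δ`), then there is ONE window function `Ω(L, M, n) > 0` (of the
sizes and of `n = r.val`; it is built on the canonical carrier `Fin (L·M)`) such that on every
admissible tube, EVERY labelling `e`, every displacement `r` with `R ≤ r̂`, every normalised
`(N_{L,M}(δ), S^z = 0)` sector vector `φ` of energy `Re⟨φ, H₀φ⟩ ≤ E₀ + Ω(L, M, r.val)` obeys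
`(A/2)·L·M²·r̂^{-Ξ√(ẽ″/ρ̃)/M} ≤ G_φ(r)` — the hypothesis of `haldaneLaw_of_windowLaw` /
`feshbachStep` with constants `(Ξ, A/2, R, M₂, L₁)`. The window found on the canonical carrier
serves every labelling because the signed-permutation relabelling transports the Hamiltonian, the
sector, norms, expectations, sector minima, the two thermodynamic responses and the column pair
correlator. [folklore] -/
theorem windowLaw_of_haldaneLaw {U δ Ξ A : ℝ} {R M₂ L₁ : ℕ} (hA : 0 < A)
    (hlaw : HaldaneLaw U δ Ξ A R M₂ L₁) :
    ∃ Ω : ℕ → ℕ → ℕ → ℝ, (∀ L M n, 0 < Ω L M n) ∧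
      ∀ (L M : ℕ) [NeZero L] [NeZero M], Even L → Even M → M₂ ≤ M → M ≤ L → L₁ ≤ L →
        ∀ (Λ : Type) [LinearOrder Λ] [Fintype Λ] (e : Λ ≃ ZMod L × ZMod M) (r : ZMod L),
          R ≤ r.val → r.val + R ≤ L →
            ∀ φ : Fock (Orb Λ), φ ∈ szSector (tubeFilling L M δ) 0 → star φ ⬝ᵥ φ = 1 →
              (expect (tubeH0 L M Λ e U) φ).re ≤
                  (tubeH0 L M Λ e U).minEnergyOn (szSector (tubeFilling L M δ) 0) + Ω L M r.val →
                (A / 2) * (L : ℝ) * (M : ℝ) ^ 2 * ((min r.val (L - r.val) : ℕ) : ℝ) ^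
                    (-(Ξ * Real.sqrt (tubePairCompressibility L M Λ e U δ / tubeStiffness L M Λ e U δ) / (M : ℝ))) ≤
                  tubeColumnPairCorr L M Λ e φ r := by
  have key : ∀ L M n : ℕ, ∃ Ω : ℝ, 0 < Ω ∧ ∀ [NeZero L] [NeZero M], Even L → Even M → M₂ ≤ M →
      M ≤ L → L₁ ≤ L → ∀ r : ZMod L, r.val = n → R ≤ r.val → r.val + R ≤ L →
        ∀ φ : Fock (Orb (Fin (L * M))), φ ∈ szSector (tubeFilling L M δ) 0 → star φ ⬝ᵥ φ = 1 →
          (expect (tubeH0 L M (Fin (L * M))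
              (finProdFinEquiv.symm.trans
                (Equiv.prodCongr (ZMod.finEquiv L).toEquiv (ZMod.finEquiv M).toEquiv)) U) φ).re ≤
              (tubeH0 L M (Fin (L * M))
                (finProdFinEquiv.symm.trans
                  (Equiv.prodCongr (ZMod.finEquiv L).toEquiv (ZMod.finEquiv M).toEquiv)) U).minEnergyOn
                (szSector (tubeFilling L M δ) 0) + Ω →
            (A / 2) * (L : ℝ) * (M : ℝ) ^ 2 * ((min r.val (L - r.val) : ℕ) : ℝ) ^
                (-(Ξ * Real.sqrt (tubePairCompressibility L M (Fin (L * M))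
                  (finProdFinEquiv.symm.trans
                    (Equiv.prodCongr (ZMod.finEquiv L).toEquiv (ZMod.finEquiv M).toEquiv)) U δ /
                  tubeStiffness L M (Fin (L * M))
                    (finProdFinEquiv.symm.trans
                      (Equiv.prodCongr (ZMod.finEquiv L).toEquiv (ZMod.finEquiv M).toEquiv)) U δ) / (M : ℝ))) ≤
              tubeColumnPairCorr L M (Fin (L * M))
                (finProdFinEquiv.symm.trans
                  (Equiv.prodCongr (ZMod.finEquiv L).toEquiv (ZMod.finEquiv M).toEquiv)) φ r := by
    intro L M n
    by_cases hLM : L ≠ 0 ∧ M ≠ 0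
    · haveI : NeZero L := ⟨hLM.1⟩
      haveI : NeZero M := ⟨hLM.2⟩
      by_cases hadm : Even L ∧ Even M ∧ M₂ ≤ M ∧ M ≤ L ∧ L₁ ≤ L ∧ n < L ∧ R ≤ n ∧ n + R ≤ L
      · obtain ⟨hLe, hMe, hM, hML, hL, hnL, hRn, hnR⟩ := hadm
        have hval : ((n : ℕ) : ZMod L).val = n := ZMod.val_cast_of_lt hnL
        obtain ⟨Ω, hΩ, hwin⟩ := exists_window_at L M (Fin (L * M))
          (finProdFinEquiv.symm.trans
            (Equiv.prodCongr (ZMod.finEquiv L).toEquiv (ZMod.finEquiv M).toEquiv))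
          hA hlaw hLe hMe hM hML hL ((n : ℕ) : ZMod L) (by rw [hval]; exact hRn)
          (by rw [hval]; exact hnR)
        refine ⟨Ω, hΩ, ?_⟩
        intro _ _ _ _ _ _ _ r hrn _ _ φ hφK hφ1 hφwin
        have hr' : r = ((n : ℕ) : ZMod L) := by rw [← hrn, ZMod.natCast_zmod_val]
        subst hr'
        exact hwin φ hφK hφ1 hφwin
      · refine ⟨1, one_pos, ?_⟩
        intro _ _ hLe hMe hM hML hL r hrn hr hrL
        exact absurd ⟨hLe, hMe, hM, hML, hL, hrn ▸ r.val_lt, hrn ▸ hr, hrn ▸ hrL⟩ hadm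
    · refine ⟨1, one_pos, ?_⟩
      intro hL' hM'
      exact absurd ⟨hL'.out, hM'.out⟩ hLM
  choose Ω hΩ hwin using key
  refine ⟨Ω, hΩ, ?_⟩
  intro L M _ _ hLe hMe hM hML hL Λ _ _ e r hr hrL φ hφK hφ1 hφwin
  set e₀ : Fin (L * M) ≃ ZMod L × ZMod M := finProdFinEquiv.symm.trans
    (Equiv.prodCongr (ZMod.finEquiv L).toEquiv (ZMod.finEquiv M).toEquiv) with he₀
  have hwin' : (expect (tubeH0 L M (Fin (L * M)) e₀ U)
      (relabelVec (Orb.mapEquiv (e.trans e₀.symm)) φ)).re ≤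
      (tubeH0 L M (Fin (L * M)) e₀ U).minEnergyOn (szSector (tubeFilling L M δ) 0) + Ω L M r.val := by
    rw [← relabel_tubeH0 L M Λ e _ e₀ U, expect_relabel_relabelVec, minEnergyOn_relabel_szSector]
    exact hφwin
  have key := hwin L M r.val hLe hMe hM hML hL r rfl hr hrL
    (relabelVec (Orb.mapEquiv (e.trans e₀.symm)) φ) (mem_szSector_relabelVec _ hφK)
    (by rw [star_relabelVec_self, hφ1]) hwin'
  rwa [tubeColumnPairCorr_relabelVec, ← tubeStiffness_relabel L M Λ e _ e₀,
    ← tubePairCompressibility_relabel L M Λ e _ e₀] at key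

/-! ### The window bridge is the crux -/

/-- **Core A of line `IdeaSketchK2` ⟺ `WidthHaldaneBridge`** (stmt-HubbardSuperconductivity-16311).
The WINDOW BRIDGE — width-uniform thermodynamics ⇒ for some Haldane constants and some everywhere
positive window `Ω(L, M, r)`, the floor `A·L·M²·r̂^{-Ξ√(ẽ″/ρ̃)/M} ≤ G_φ(r)` for EVERY normalised
`(N_{L,M}(δ), S^z = 0)` sector vector `φ` of energy `≤ E₀ + Ω` (verbatim `stub_windowBridge` of
`Cruxes/WidthHaldaneBridge/Lines/IdeaSketchK2.lean`) — holds iff the Bridge holds: `→` is the line's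
composition A (`haldaneLaw_of_windowLaw`, same constants), `←` is `windowLaw_of_haldaneLaw` (amplitude
`A/2`). So the window law is a restatement of the crux: a line whose hardest stub is a window law has
not decomposed `WidthHaldaneBridge`. [folklore] -/
theorem windowBridge_iff_widthHaldaneBridge : (∀ U : ℝ, 0 < U → ∀ δ ∈ Set.Ioo (0 : ℝ) (3 / 10), ∀ (d₀ k₀ : ℝ) (M₁ L₀ : ℕ), 0 < d₀ → UniformThermo U δ d₀ k₀ M₁ L₀ → ∃ Ξ : ℝ, 0 < Ξ ∧ ∃ A : ℝ, 0 < A ∧ ∃ (R M₂ L₁ : ℕ) (Ω : ℕ → ℕ → ℕ → ℝ), (∀ L M n, 0 < Ω L M n) ∧ ∀ (L M : ℕ) [NeZero L] [NeZero M], Even L → Even M → M₂ ≤ M → M ≤ L → L₁ ≤ L → ∀ (Λ : Type) [LinearOrder Λ] [Fintype Λ] (e : Λ ≃ ZMod L × ZMod M) (r : ZMod L), R ≤ r.val → r.val + R ≤ L → ∀ φ : Fock (Orb Λ), φ ∈ szSector (tubeFilling L M δ) 0 → star φ ⬝ᵥ φ = 1 → (expect (tubeH0 L M Λ e U) φ).re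 ≤ (tubeH0 L M Λ e U).minEnergyOn (szSector (tubeFilling L M δ) 0) + Ω L M r.val → A * (L : ℝ) * (M : ℝ) ^ 2 * ((min r.val (L - r.val) : ℕ) : ℝ) ^ (-(Ξ * Real.sqrt (tubePairCompressibility L M Λ e U δ / tubeStiffness L M Λ e U δ) / (M : ℝ))) ≤ tubeColumnPairCorr L M Λ e φ r) ↔ Summit.HubbardSuperconductivity.HubbardSuperconductivity.Theses.WidthHaldane.WidthHaldaneBridge := by
  rw [widthHaldaneBridge_iff]
  constructor
  · intro hW U hU δ hδ d₀ k₀ M₁ L₀ hd₀ hth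
    obtain ⟨Ξ, hΞ, A, hA, R, M₂, L₁, Ω, hΩ, hwin⟩ := hW U hU δ hδ d₀ k₀ M₁ L₀ hd₀ hth
    exact ⟨Ξ, hΞ, A, hA, R, M₂, L₁, haldaneLaw_of_windowLaw (by linarith [hδ.1]) Ω hΩ hwin⟩
  · intro hB U hU δ hδ d₀ k₀ M₁ L₀ hd₀ hth
    obtain ⟨Ξ, hΞ, A, hA, R, M₂, L₁, hlaw⟩ := hB U hU δ hδ d₀ k₀ M₁ L₀ hd₀ hth
    obtain ⟨Ω, hΩ, hwin⟩ := windowLaw_of_haldaneLaw hA hlaw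
    exact ⟨Ξ, hΞ, A / 2, by positivity, R, M₂, L₁, Ω, hΩ, hwin⟩

end Summit.HubbardSuperconductivity.HubbardSuperconductivity.Theorems.WidthHaldane

end
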